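import Mathlib
import Summits.ResolutionOfSingularities.ResolutionOfSingularities.Theses.SyzygyFlattening
import Summits.ResolutionOfSingularities.ResolutionOfSingularities.Theorems.SyzygyFlatteningDefs
import Summits.ResolutionOfSingularities.ResolutionOfSingularities.Theorems.SyzygyFlatteningHigherRankTerminationCruxIsResidualSteering
import Summits.ResolutionOfSingularities.ResolutionOfSingularities.Theorems.SyzygyFlatteningRankOneTerminationReduction
import Summits.ResolutionOfSingularities.ResolutionOfSingularities.Theorems.SyzygyFlatteningRankOneTerminationSurfaceCase
import Literature.AlgebraicGeometry.Resolution.LipmanValuativeQuadraticSequence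
import Literature.AlgebraicGeometry.Resolution.LipmanValuativeQuadraticSequenceProofs
import HarnessLib

/-!
# `HigherRankTermination` is residual steering in transcendence degree `≥ 3`, modulo Lipman 1978

Crux `HigherRankTermination` (stmt-ResolutionOfSingularities-17045), line `birth`, lead c3 — the index slicing of
skeleton v11, landed as theorems. By `higherRankTermination_iff_residualSteering` (lead c2, p170425) the crux IS
"`RankOneInput p` ⇒ residual steering" (for a dimension-zero `O` with a proper coarsening `O < O₁ < K` at whose centre
the `O`-tower is eventually regular, the tower terminates). Slice by the syzygy index `n = tr.deg_k K`:

* `n ≤ 1`: unconditional, any valuation ring (`towerTerminates_of_syzygyIndex_le_one`, crux #2's landed curve case);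
* `n = 2`: Lipman's theorem along a valuation — crux #2's landed `stub_surfaceCase` turns the valuative Lipman
  statement (the tree's named fact `Lipman1978ValuativeQuadraticSequence`, PROVED there from the scheme-level named
  fact `Lipman1978SequenceFinite` by `Lipman1978ValuativeQuadraticSequence.of_sequenceFinite`) into termination
  along EVERY valuation ring;
* `n ≥ 3`: the open core (registered stub `stub_residualSteering_three_le` of `Lines/birth.lean` v11).

Results (all kernel-checked; the Lipman statement enters only as an explicit hypothesis `hL`, never as an axiom):
`towerTerminates_of_syzygyIndex_le_two_of_lipman` (small index, any valuation ring),
`residualSteering_three_le_of_higherRankTermination` (unconditional weakening),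
`higherRankTermination_of_lipman_of_residualSteering_three_le`,
`higherRankTermination_iff_residualSteering_three_le_of_lipman` and `…_of_sequenceFinite` — modulo Lipman 1978 the
crux is EXACTLY residual steering in transcendence degree `≥ 3` — and the unconditional split
`higherRankTermination_iff_split` (small-index slice ∧ `n ≥ 3` slice).

References: Lipman 1978, Theorem p. 151; Liu 2002, Thm. 8.3.44; Novacoski–Spivakovsky 2014, Thm. 1.1 (shape of the
reduction to rank one).
-/

noncomputable section

-- single-problem summit: the doubled namespace component `ResolutionOfSingularities` is forced
set_option linter.dupNamespace false

open Summit.ResolutionOfSingularities.ResolutionOfSingularities.Theses.SyzygyFlattening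
  (HigherRankTermination)
open Literature.AlgebraicGeometry.Resolution (Lipman1978ValuativeQuadraticSequence Lipman1978SequenceFinite)

namespace Summit.ResolutionOfSingularities.ResolutionOfSingularities.Theorems.SyzygyFlattening

/-! ## Small index: curves and surfaces, along any valuation ring -/

/-- **Index `≤ 2`, any valuation ring, modulo Lipman.** For `tr.deg_k K ≤ 2` the syzygy-flattening tower terminates
along EVERY valuation ring `O ⊇ A ⊇ k` of `K = Frac A` (no rank, dimension or `RankOneInput` hypothesis): `n ≤ 1` is
the landed curve case, `n = 2` is crux #2's landed `stub_surfaceCase` fed with the valuative Lipman statement `hL`.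
[cite: Lipman1978, Theorem p. 151; Liu2002, Thm. 8.3.44] -/
theorem towerTerminates_of_syzygyIndex_le_two_of_lipman (hL : Lipman1978ValuativeQuadraticSequence.{0})
    {k K : Type} [Field k] [Field K] [Algebra k K] (O : ValuationSubring K) (A : Subalgebra k K)
    (hk : ∀ c : k, algebraMap k K c ∈ O) (hFG : A.FG) (hFrac : IsFractionRing ↥A K)
    (hAO : A.toSubring ≤ O.toSubring) (hn : syzygyIndex k K ≤ 2) : TowerTerminates O A := by
  by_cases h1 : syzygyIndex k K ≤ 1
  · exact towerTerminates_of_syzygyIndex_le_one O A hk hFG hFrac hAO h1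
  · exact stub_surfaceCase hL k K O A hk hFG hFrac hAO (by omega)

/-! ## The `n ≥ 3` slice of residual steering -/

/-- **Unconditional weakening**: `HigherRankTermination` implies residual steering in transcendence degree `≥ 3`
(the statement of the registered stub `stub_residualSteering_three_le`, which carries `RankOneInput p`).
[folklore] -/
theorem residualSteering_three_le_of_higherRankTermination (h : HigherRankTermination) :
    ∀ (p : ℕ), p.Prime → RankOneInput p →
      ∀ (k K : Type) [Field k] [CharP k p] [Field K] [Algebra k K] (O : ValuationSubring K)
        (A : Subalgebra k K), (∀ c : k, algebraMap k K c ∈ O) → A.FG → IsFractionRing ↥A K →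
        A.toSubring ≤ O.toSubring → DimZero k O → 3 ≤ syzygyIndex k K →
        ∀ O₁ : ValuationSubring K, O < O₁ → O₁ ≠ ⊤ → EventuallyRegularAlong O A O₁ →
        TowerTerminates O A :=
  fun p hp hR1 k K _ _ _ _ O A hk hFG hFrac hAO halg _ O₁ hlt hO₁top hev =>
    (higherRankTermination_iff_residualSteering.mp h) p hp hR1 k K O A hk hFG hFrac hAO halg O₁ hlt
      hO₁top hev

/-- **Residual steering for every index from its `n ≥ 3` slice, modulo Lipman**: small indices are
`towerTerminates_of_syzygyIndex_le_two_of_lipman` (the coarsening and the eventual regularity are not even used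
there). [cite: Lipman1978, Theorem p. 151] -/
theorem residualSteering_of_lipman_of_three_le (hL : Lipman1978ValuativeQuadraticSequence.{0})
    (h3 : ∀ (p : ℕ), p.Prime → RankOneInput p →
      ∀ (k K : Type) [Field k] [CharP k p] [Field K] [Algebra k K] (O : ValuationSubring K)
        (A : Subalgebra k K), (∀ c : k, algebraMap k K c ∈ O) → A.FG → IsFractionRing ↥A K →
        A.toSubring ≤ O.toSubring → DimZero k O → 3 ≤ syzygyIndex k K →
        ∀ O₁ : ValuationSubring K, O < O₁ → O₁ ≠ ⊤ → EventuallyRegularAlong O A O₁ →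
        TowerTerminates O A) :
    ∀ (p : ℕ), p.Prime → RankOneInput p →
      ∀ (k K : Type) [Field k] [CharP k p] [Field K] [Algebra k K] (O : ValuationSubring K)
        (A : Subalgebra k K), (∀ c : k, algebraMap k K c ∈ O) → A.FG → IsFractionRing ↥A K →
        A.toSubring ≤ O.toSubring → DimZero k O →
        ∀ O₁ : ValuationSubring K, O < O₁ → O₁ ≠ ⊤ → EventuallyRegularAlong O A O₁ →
        TowerTerminates O A := by
  intro p hp hR1 k K _ _ _ _ O A hk hFG hFrac hAO halg O₁ hlt hO₁top hev
  by_cases h2 : syzygyIndex k K ≤ 2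
  · exact towerTerminates_of_syzygyIndex_le_two_of_lipman hL O A hk hFG hFrac hAO h2
  · exact h3 p hp hR1 k K O A hk hFG hFrac hAO halg (by omega) O₁ hlt hO₁top hev

/-- **The crux from its `n ≥ 3` core, modulo Lipman**: `Lipman1978ValuativeQuadraticSequence` and residual
steering in transcendence degree `≥ 3` imply `HigherRankTermination` (through
`higherRankTermination_iff_residualSteering`). This is the composition of skeleton v11 of `Lines/birth.lean` with its
named-fact stub made an explicit hypothesis. [cite: Lipman1978, Theorem p. 151; NovacoskiSpivakovsky2014, Thm. 1.1] -/
theorem higherRankTermination_of_lipman_of_residualSteering_three_le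
    (hL : Lipman1978ValuativeQuadraticSequence.{0})
    (h3 : ∀ (p : ℕ), p.Prime → RankOneInput p →
      ∀ (k K : Type) [Field k] [CharP k p] [Field K] [Algebra k K] (O : ValuationSubring K)
        (A : Subalgebra k K), (∀ c : k, algebraMap k K c ∈ O) → A.FG → IsFractionRing ↥A K →
        A.toSubring ≤ O.toSubring → DimZero k O → 3 ≤ syzygyIndex k K →
        ∀ O₁ : ValuationSubring K, O < O₁ → O₁ ≠ ⊤ → EventuallyRegularAlong O A O₁ →
        TowerTerminates O A) :
    HigherRankTermination :=
  higherRankTermination_iff_residualSteering.mpr (residualSteering_of_lipman_of_three_le hL h3)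

/-- **Modulo Lipman 1978, `HigherRankTermination` is EQUIVALENT to residual steering in transcendence degree
`≥ 3`** (hypothesis: the valuative Lipman statement). So, exactly as for crux #2 (`stub_higherDimSlice`), the open
content of crux #3 sits entirely in `tr.deg_k K ≥ 3`. [cite: Lipman1978, Theorem p. 151; Liu2002, Thm. 8.3.44] -/
theorem higherRankTermination_iff_residualSteering_three_le_of_lipman
    (hL : Lipman1978ValuativeQuadraticSequence.{0}) :
    HigherRankTermination ↔
      ∀ (p : ℕ), p.Prime → RankOneInput p →
        ∀ (k K : Type) [Field k] [CharP k p] [Field K] [Algebra k K] (O : ValuationSubring K)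
          (A : Subalgebra k K), (∀ c : k, algebraMap k K c ∈ O) → A.FG → IsFractionRing ↥A K →
          A.toSubring ≤ O.toSubring → DimZero k O → 3 ≤ syzygyIndex k K →
          ∀ O₁ : ValuationSubring K, O < O₁ → O₁ ≠ ⊤ → EventuallyRegularAlong O A O₁ →
          TowerTerminates O A :=
  ⟨residualSteering_three_le_of_higherRankTermination,
    higherRankTermination_of_lipman_of_residualSteering_three_le hL⟩

/-- **The same equivalence from the scheme-level named fact** `Lipman1978SequenceFinite` (Liu 2002, Thm. 8.3.44:
the sequence "blow up the reduced singular locus, normalise" of a normal surface is finite), through the tree's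
PROVED bridge `Lipman1978ValuativeQuadraticSequence.of_sequenceFinite`.
[cite: Liu2002, Thm. 8.3.44; Lipman1978, Theorem p. 151] -/
theorem higherRankTermination_iff_residualSteering_three_le_of_sequenceFinite
    (h : Lipman1978SequenceFinite.{0}) :
    HigherRankTermination ↔
      ∀ (p : ℕ), p.Prime → RankOneInput p →
        ∀ (k K : Type) [Field k] [CharP k p] [Field K] [Algebra k K] (O : ValuationSubring K)
          (A : Subalgebra k K), (∀ c : k, algebraMap k K c ∈ O) → A.FG → IsFractionRing ↥A K →
          A.toSubring ≤ O.toSubring → DimZero k O → 3 ≤ syzygyIndex k K →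
          ∀ O₁ : ValuationSubring K, O < O₁ → O₁ ≠ ⊤ → EventuallyRegularAlong O A O₁ →
          TowerTerminates O A :=
  higherRankTermination_iff_residualSteering_three_le_of_lipman
    (Lipman1978ValuativeQuadraticSequence.of_sequenceFinite h)

/-! ## The unconditional split by index -/

/-- **Unconditional index split of the crux**: `HigherRankTermination` iff (`RankOneInput p` ⇒ residual steering
for `tr.deg ≤ 2`) and (`RankOneInput p` ⇒ residual steering for `tr.deg ≥ 3`). The first conjunct is Lipman-grade
(`towerTerminates_of_syzygyIndex_le_two_of_lipman` discharges it modulo the named fact, and needs neither the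
coarsening nor `RankOneInput`); the second is the registered core stub. [folklore] -/
theorem higherRankTermination_iff_split :
    HigherRankTermination ↔
      (∀ (p : ℕ), p.Prime → RankOneInput p →
        ∀ (k K : Type) [Field k] [CharP k p] [Field K] [Algebra k K] (O : ValuationSubring K)
          (A : Subalgebra k K), (∀ c : k, algebraMap k K c ∈ O) → A.FG → IsFractionRing ↥A K →
          A.toSubring ≤ O.toSubring → DimZero k O → syzygyIndex k K ≤ 2 →
          ∀ O₁ : ValuationSubring K, O < O₁ → O₁ ≠ ⊤ → EventuallyRegularAlong O A O₁ →
          TowerTerminates O A) ∧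
      (∀ (p : ℕ), p.Prime → RankOneInput p →
        ∀ (k K : Type) [Field k] [CharP k p] [Field K] [Algebra k K] (O : ValuationSubring K)
          (A : Subalgebra k K), (∀ c : k, algebraMap k K c ∈ O) → A.FG → IsFractionRing ↥A K →
          A.toSubring ≤ O.toSubring → DimZero k O → 3 ≤ syzygyIndex k K →
          ∀ O₁ : ValuationSubring K, O < O₁ → O₁ ≠ ⊤ → EventuallyRegularAlong O A O₁ →
          TowerTerminates O A) := by
  rw [higherRankTermination_iff_residualSteering]
  constructor
  · intro h
    exact ⟨fun p hp hR1 k K _ _ _ _ O A hk hFG hFrac hAO halg _ O₁ hlt hO₁top hev =>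
        h p hp hR1 k K O A hk hFG hFrac hAO halg O₁ hlt hO₁top hev,
      fun p hp hR1 k K _ _ _ _ O A hk hFG hFrac hAO halg _ O₁ hlt hO₁top hev =>
        h p hp hR1 k K O A hk hFG hFrac hAO halg O₁ hlt hO₁top hev⟩
  · rintro ⟨h2, h3⟩ p hp hR1 k K _ _ _ _ O A hk hFG hFrac hAO halg O₁ hlt hO₁top hev
    by_cases hn : syzygyIndex k K ≤ 2
    · exact h2 p hp hR1 k K O A hk hFG hFrac hAO halg hn O₁ hlt hO₁top hev
    · exact h3 p hp hR1 k K O A hk hFG hFrac hAO halg (by omega) O₁ hlt hO₁top hev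

end Summit.ResolutionOfSingularities.ResolutionOfSingularities.Theorems.SyzygyFlattening

end
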